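import Literature.NumberTheory.EllipticCurves.NewformsEigenformDegeneracySpanProofs
import Literature.NumberTheory.EllipticCurves.CuspFormsGamma0IntegralBasisProofs
import Literature.NumberTheory.EllipticCurves.NewformsCoeffFieldHolds
import Literature.NumberTheory.EllipticCurves.HeckeOperatorsProofs
import Literature.FieldTheory.AlgClosed.AutomorphismExtension
import Mathlib.Analysis.Complex.Cardinality
import HarnessLib

/-!
# Galois conjugates of newforms are newforms (Diamond–Shurman Thm. 6.5.4) — PROOF on `Γ₀(N)`, weight `k ≥ 2`

Topic `NumberTheory/EllipticCurves`; companion of `NewformsGaloisConjugate.lean` (the named fact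
`DiamondShurman2005_thm654_exists_isNewform0_conj`, weight `2`): THEOREMS ONLY. For a normalised newform `f ∈ S_k(Γ₀(N))`, `k ≥ 2`, and
a field embedding `σ : K_f → ℂ` there is a newform `f' ∈ S_k(Γ₀(N))` with `a_n(f') = σ(a_n(f))` for all `n`
(`exists_isNewform0_conj`). Proof, from the tree:
1. `σ` extends to an automorphism `σ̃` of `ℂ` (`Literature.FieldTheory.AlgClosed.exists_ringEquiv_apply_eq`; `K_f` is a number field,
   `IsNewform0.finiteDimensional_coeffField_holds`), and the conjugate CUSP FORM `h = f^{σ̃} ∈ S_k(Γ₀(N))` exists (`exists_conj_cuspForm_gamma0`,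
   Shimura's integral basis); it is `T_p`-eigen with eigenvalues `σ̃(a_p(f))`, `p ∤ N` (the `q`-expansion of `T_p`, `qExpansion_coeff_heckeT_holds`).
2. The packet `(σ̃ a_p(f))_{p ∤ N}` is the packet of SOME newform `g₁` of some level `M ∣ N`: `S_k(Γ₀(N)) = ∑_{M d ∣ N} [α_d] S_k(Γ₀(M))^{new}`
   (`iSup_atkinLehnerComponent_eq_top`, `span_newforms0_holds`) with each `[α_d] g` in the joint generalised eigenspace of its packet
   (`degeneracyMap0_mem_iInf_maxGenEigenspace`), and distinct packets are independent (`iSupIndep_iInf_maxGenEigenspace_heckeT_off_level`) — so a packet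
   met by the non-zero eigenvector `h` is met by a newform; then `h ∈ span{[α_d] g₁ : d ∣ N/M}` (`mem_span_degeneracyMap0_of_eigenpacket`).
3. If `M = N` then `h = g₁` (both normalised): a newform. If `M < N` then `h` is OLD; conjugating back by `σ̃⁻¹` — the old subspace is stable under
   coefficientwise conjugation (`mem_oldSubspace0_of_cuspCoeff_eq_conj`: `[α_d]` acts on `q`-expansions by `a_n ↦ d^{k−1} a_{n/d}`, `qExpansion_coeff_iota`,
   and conjugate forms exist at every level) — puts `f` in `old ∩ new = 0` (`disjoint_oldSubspace0_newSubspace0_holds`), contradicting `a₁(f) = 1`.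
References: [DiamondShurman2005] Thm. 6.5.4, Thm. 5.8.3; [Shimura1971] Thm. 3.52; [AtkinLehner1970] Thms. 4–5.
-/

noncomputable section

open scoped MatrixGroups ModularForm Cardinal

open CongruenceSubgroup UpperHalfPlane

namespace Literature.NumberTheory.EllipticCurves.ModularForms

namespace GaloisConjugate

variable {N : ℕ} [NeZero N] {k : ℤ}

omit [NeZero N] in
/-- `aₙ(f + g) = aₙ(f) + aₙ(g)` on `Γ₀(N)` (Mathlib's `qExpansion_add`). [folklore] -/
private theorem cuspCoeff_add (f g : CuspForm (Gamma0 N) k) (n : ℕ) : cuspCoeff (f + g) n = cuspCoeff f n + cuspCoeff g n := by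
  have h := cuspCoeff_sum_smul (Finset.univ : Finset (Fin 2)) (fun _ ↦ (1 : ℂ)) ![f, g] n
  simpa [Fin.sum_univ_two] using h

/-- **The old subspace is stable under coefficientwise conjugation** (`k ≥ 2`): if `F ∈ S_k(Γ₀(N))^{old}` and `F' ∈ S_k(Γ₀(N))` has
`aₘ(F') = τ(aₘ(F))` for a ring endomorphism `τ` of `ℂ`, then `F' ∈ S_k(Γ₀(N))^{old}` — `[α_d]_k = d^{k−1}ι_d` acts on `q`-expansions rationally
(`qExpansion_coeff_iota`) and conjugates of forms of every lower level exist (`exists_conj_cuspForm_gamma0`). [cite: DiamondShurman2005, Thm. 6.5.4 (proof)]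
[cite: Shimura1971, Thm. 3.52] -/
theorem mem_oldSubspace0_of_cuspCoeff_eq_conj (hk : 2 ≤ k) (τ : ℂ →+* ℂ) {F : CuspForm (Gamma0 N) k} (hF : F ∈ oldSubspace0 N k)
    {F' : CuspForm (Gamma0 N) k} (hF' : ∀ m, cuspCoeff F' m = τ (cuspCoeff F m)) : F' ∈ oldSubspace0 N k := by
  revert F' 
  induction hF using Submodule.iSup_induction' with
  | mem Md F hFr =>
    intro F' hF'
    obtain ⟨u, rfl⟩ := hFr
    obtain ⟨⟨M, d⟩, hM, hMd⟩ := Md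
    haveI : NeZero M := ⟨(Nat.pos_of_mem_properDivisors hM).ne'⟩
    haveI : NeZero d := ⟨fun h ↦ by simp [h] at hMd; exact NeZero.ne N hMd⟩
    obtain ⟨u', hu'⟩ := exists_conj_cuspForm_gamma0 hk τ u
    have hF'eq : F' = degeneracyMap0 M N d k u' := by
      apply eq_of_forall_cuspCoeff_eq_gamma0
      intro m
      rw [hF' m]
      change τ ((qExpansion 1 ⇑(degeneracyMap0 M N d k u)).coeff m) = (qExpansion 1 ⇑(degeneracyMap0 M N d k u')).coeff m
      rw [degeneracyMap0_eq_smul_iota M N d k hMd, degeneracyMap0_eq_smul_iota M N d k hMd, qExpansion_coeff_smul, qExpansion_coeff_smul,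
        qExpansion_coeff_iota, qExpansion_coeff_iota, map_mul, map_zpow₀, map_natCast]
      split_ifs with hdm
      · change _ * τ (cuspCoeff u (m / d)) = _ * cuspCoeff u' (m / d)
        rw [hu']
      · rw [map_zero]
    rw [hF'eq]
    exact le_iSup (fun Md : DegeneracyIndex N ↦ LinearMap.range (degeneracyMap0 Md.1.1 N Md.1.2 k)) ⟨(M, d), hM, hMd⟩ (LinearMap.mem_range_self _ _)
  | zero =>
    intro F' hF'
    have h0 : ∀ m, cuspCoeff (0 : CuspForm (Gamma0 N) k) m = 0 := fun m ↦ by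
      have h := qExpansion_coeff_smul N k (0 : ℂ) F' m
      rw [zero_mul, zero_smul] at h
      exact h
    have : F' = 0 := by
      apply eq_of_forall_cuspCoeff_eq_gamma0
      intro m
      rw [hF' m, h0, map_zero]
    rw [this]; exact zero_mem _
  | add F₁ F₂ _ _ h₁ h₂ =>
    intro F' hF'
    obtain ⟨F₁', hF₁'⟩ := exists_conj_cuspForm_gamma0 hk τ F₁
    obtain ⟨F₂', hF₂'⟩ := exists_conj_cuspForm_gamma0 hk τ F₂
    have : F' = F₁' + F₂' := by
      apply eq_of_forall_cuspCoeff_eq_gamma0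
      intro m
      rw [hF' m, cuspCoeff_add, cuspCoeff_add, map_add, hF₁', hF₂']
    rw [this]
    exact add_mem (h₁ hF₁') (h₂ hF₂')

/-- The number field `K_f` of a newform is countable (it is finite-dimensional over `ℚ`, `IsNewform0.finiteDimensional_coeffField_holds`). [folklore] -/
private theorem mk_coeffField_le_aleph0 {f : CuspForm (Gamma0 N) k} (hf : IsNewform0 f) : #(coeffField f) ≤ ℵ₀ := by
  haveI : FiniteDimensional ℚ (coeffField f) := IsNewform0.finiteDimensional_coeffField_holds hf
  let b := Module.finBasis ℚ (coeffField f)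
  haveI : Countable (coeffField f) := Function.Injective.countable b.equivFun.injective
  exact Cardinal.mk_le_aleph0

/-- ★★★ **Diamond–Shurman, Theorem 6.5.4 on `Γ₀(N)`, PROVED (any weight `k ≥ 2`)**: for a normalised newform `f ∈ S_k(Γ₀(N))` and any field
embedding `σ : K_f → ℂ`, the conjugate `f^σ = ∑ σ(a_n) qⁿ` is a normalised newform of `S_k(Γ₀(N))`: there is `f'` with `IsNewform0 f'` and
`a_n(f') = σ(a_n(f))` for all `n`. (See the module docstring for the proof.) [cite: DiamondShurman2005, Thm. 6.5.4] [cite: AtkinLehner1970, Thm. 4 and Thm. 5] -/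
theorem exists_isNewform0_conj (hk : 2 ≤ k) (f : CuspForm (Gamma0 N) k) (hf : IsNewform0 f) (σ : coeffField f →+* ℂ) :
    ∃ f' : CuspForm (Gamma0 N) k, IsNewform0 f' ∧ ∀ n : ℕ, cuspCoeff f' n = σ ⟨cuspCoeff f n, coeff_mem_coeffField f n⟩ := by
  classical
  have hf0 : f ≠ 0 := IsNormalized.ne_zero_gamma0 hf.2.2
  -- (1) extend `σ` to an automorphism of `ℂ`, conjugate the cusp form
  obtain ⟨σ', hσ'⟩ := Literature.FieldTheory.AlgClosed.exists_ringEquiv_apply_eq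
    (by rw [Cardinal.mk_complex]; exact Cardinal.aleph0_lt_continuum) (mk_coeffField_le_aleph0 hf)
    (algebraMap (coeffField f) ℂ) σ
  obtain ⟨h, hh0'⟩ := exists_conj_cuspForm_gamma0 hk (σ' : ℂ →+* ℂ) f
  have hh : ∀ m : ℕ, cuspCoeff h m = σ' (cuspCoeff f m) := fun m ↦ hh0' m
  have hhσ : ∀ n : ℕ, cuspCoeff h n = σ ⟨cuspCoeff f n, coeff_mem_coeffField f n⟩ := fun n ↦ by
    rw [hh n, ← hσ']; rfl
  have hh1 : cuspCoeff h 1 = 1 := by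
    rw [hh 1, show cuspCoeff f 1 = 1 from hf.2.2, map_one]
  have hh0 : h ≠ 0 := IsNormalized.ne_zero_gamma0 hh1
  -- `h` is `T_p`-eigen with eigenvalue `σ'(a_p(f))` for `p ∤ N`
  have hT : ∀ (p : ℕ) (hp : p.Prime), ¬ p ∣ N → (haveI : NeZero p := ⟨hp.ne_zero⟩; heckeT (Gamma0 N) k p h) = σ' (cuspCoeff f p) • h := by
    intro p hp hpN
    haveI : NeZero p := ⟨hp.ne_zero⟩
    have hTf : heckeT (Gamma0 N) k p f = (cuspCoeff f p) • f := hf.heckeT_eq_coeff_smul hp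
    apply eq_of_forall_cuspCoeff_eq_gamma0
    intro n
    change (qExpansion 1 ⇑(heckeT (Gamma0 N) k p h)).coeff n = (qExpansion 1 ⇑(σ' (cuspCoeff f p) • h)).coeff n
    rw [qExpansion_coeff_heckeT_holds N k h p hp n, qExpansion_coeff_smul]
    have hfn := congrArg (fun F : CuspForm (Gamma0 N) k ↦ (qExpansion 1 ⇑F).coeff n) hTf
    simp only [qExpansion_coeff_heckeT_holds N k f p hp n, qExpansion_coeff_smul] at hfn
    change cuspCoeff h (p * n) + _ = σ' (cuspCoeff f p) * cuspCoeff h n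
    change cuspCoeff f (p * n) + _ = cuspCoeff f p * cuspCoeff f n at hfn
    rw [hh (p * n), hh n, ← map_mul, ← hfn, map_add, if_neg hpN, if_neg hpN]
    split_ifs with hpn
    · change _ + _ * cuspCoeff h (n / p) = _
      rw [hh (n / p), map_mul, map_zpow₀, map_natCast]
      rfl
    · simp
  -- (2) the packet of `h` is the packet of a newform `g₁` of some level `M ∣ N`
  let I : Type := {p : ℕ // p.Prime ∧ ¬ p ∣ N}
  let V : (I → ℂ) → Submodule ℂ (CuspForm (Gamma0 N) k) := fun θ ↦
    ⨅ p : I, Module.End.maxGenEigenspace (haveI : NeZero p.1 := ⟨p.2.1.ne_zero⟩; heckeT (Gamma0 N) k p.1) (θ p)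
  have hind : iSupIndep V := iSupIndep_iInf_maxGenEigenspace_heckeT_off_level N k
  let θ' : I → ℂ := fun p ↦ σ' (cuspCoeff f p.1)
  have hhV : h ∈ V θ' := by
    refine (Submodule.mem_iInf _).mpr fun p ↦ Module.End.eigenspace_le_maxGenEigenspace ?_
    rw [Module.End.mem_eigenspace_iff]
    exact hT p.1 p.2.1 p.2.2
  have hex : ∃ (x : AtkinLehnerIndex N) (g₁ : CuspForm (Gamma0 x.1.1) k), IsNewform0 g₁ ∧ (fun p : I ↦ heckeEigenvalue g₁ p.1) = θ' := by
    by_contra hne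
    push Not at hne
    -- then everything lies in the other joint eigenspaces
    have htop : (⊤ : Submodule ℂ (CuspForm (Gamma0 N) k)) ≤ ⨆ θ ∈ ({θ'}ᶜ : Set (I → ℂ)), V θ := by
      rw [← iSup_atkinLehnerComponent_eq_top k N]
      refine iSup_le fun x ↦ ?_
      rw [atkinLehnerComponent, ← span_newforms0_holds x.1.1 k, Submodule.map_span, Submodule.span_le]
      rintro _ ⟨g, hg, rfl⟩
      have hg' : IsNewform0 g := hg
      have hθ : (fun p : I ↦ heckeEigenvalue g p.1) ≠ θ' := hne x g hg'
      have hmem : degeneracyMap0 x.1.1 N x.1.2 k g ∈ V (fun p : I ↦ heckeEigenvalue g p.1) := degeneracyMap0_mem_iInf_maxGenEigenspace x.2 hg'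
      exact (le_biSup V (show _ ∈ ({θ'}ᶜ : Set (I → ℂ)) from hθ)) hmem
    have hdis : Disjoint (V θ') (⨆ θ ∈ ({θ'}ᶜ : Set (I → ℂ)), V θ) := hind.disjoint_biSup (fun h0 ↦ h0 rfl)
    exact hh0 ((Submodule.disjoint_def.mp hdis) h hhV (htop Submodule.mem_top))
  obtain ⟨⟨⟨M, d⟩, hMd⟩, g₁, hg₁, hθ⟩ := hex
  haveI : NeZero M := ⟨fun h0 ↦ by simp [h0] at hMd; exact NeZero.ne N hMd⟩
  have hMN : M ∣ N := Dvd.dvd.trans (Dvd.intro d rfl) hMd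
  -- `h ∈ span {[α_e] g₁ : e ∣ N/M}`
  have hT₁ : ∀ (p : ℕ) (hp : p.Prime), ¬ p ∣ N → (haveI : NeZero p := ⟨hp.ne_zero⟩; heckeT (Gamma0 N) k p h) = cuspCoeff g₁ p • h := by
    intro p hp hpN
    rw [hT p hp hpN]
    congr 1
    have h1 := congr_fun hθ ⟨p, hp, hpN⟩
    simp only [θ'] at h1
    rw [← h1]
    exact heckeEigenvalue_eq_coeff_of_isNormalized hg₁.2.2 hp (hg₁.2.1 p hp)
  have hspan := mem_span_degeneracyMap0_of_eigenpacket hMN hg₁ hT₁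
  by_cases hMeq : M = N
  · -- (3a) same level: `h = g₁`
    subst hMeq
    have hdiv : (M / M).divisors = {1} := by rw [Nat.div_self (NeZero.pos M)]; rfl
    have hspan' : h ∈ Submodule.span ℂ {degeneracyMap0 M M 1 k g₁} := by
      refine Submodule.span_mono ?_ hspan
      rintro _ ⟨⟨e, he⟩, rfl⟩
      have he1 : e = 1 := by rw [hdiv] at he; simpa using he
      subst he1
      rfl
    rw [Submodule.mem_span_singleton] at hspan'
    obtain ⟨c, hc⟩ := hspan'
    have hg1 : degeneracyMap0 M M 1 k g₁ = g₁ := by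
      apply eq_of_forall_cuspCoeff_eq_gamma0
      intro m
      change (qExpansion 1 ⇑(degeneracyMap0 M M 1 k g₁)).coeff m = _
      rw [qExpansion_degeneracyMap0_one M M k dvd_rfl]
      rfl
    rw [hg1] at hc
    have hc1 : c = 1 := by
      have := congrArg (fun F : CuspForm (Gamma0 M) k ↦ cuspCoeff F 1) hc
      change (qExpansion 1 ⇑(c • g₁)).coeff 1 = cuspCoeff h 1 at this
      rw [qExpansion_coeff_smul, hh1, show (qExpansion 1 ⇑g₁).coeff 1 = 1 from hg₁.2.2, mul_one] at this
      exact this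
    rw [hc1, one_smul] at hc
    exact ⟨g₁, hg₁, fun n ↦ by rw [hc]; exact hhσ n⟩
  · -- (3b) lower level: `h` is old, hence so is `f` — contradiction
    exfalso
    have hMp : M ∈ N.properDivisors := Nat.mem_properDivisors.mpr ⟨hMN, lt_of_le_of_ne (Nat.le_of_dvd (NeZero.pos N) hMN) hMeq⟩
    have hold : h ∈ oldSubspace0 N k := by
      refine Submodule.span_le.mpr ?_ hspan
      rintro _ ⟨⟨e, he⟩, rfl⟩
      haveI : NeZero e := neZero_of_mem_divisors_div he
      exact le_iSup (fun Md : DegeneracyIndex N ↦ LinearMap.range (degeneracyMap0 Md.1.1 N Md.1.2 k)) ⟨(M, e), hMp, mul_dvd_of_mem_divisors_div hMN he⟩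
        (LinearMap.mem_range_self _ _)
    have hfold : f ∈ oldSubspace0 N k := by
      refine mem_oldSubspace0_of_cuspCoeff_eq_conj hk (σ'.symm : ℂ →+* ℂ) hold fun m ↦ ?_
      rw [hh m]
      exact (σ'.symm_apply_apply _).symm
    have hzero : f = 0 := by
      have hdis := disjoint_oldSubspace0_newSubspace0_holds N k
      exact (Submodule.disjoint_def.mp hdis) f hfold hf.1
    exact hf0 hzero

end GaloisConjugate

end Literature.NumberTheory.EllipticCurves.ModularForms

end
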